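import Summits.BirchSwinnertonDyer.BirchSwinnertonDyer.Theorems.ClassRecordThreeShimuraKolyvaginOrderBoundAtThreeSurjHOfPrimitives
import Literature.NumberTheory.EllipticCurves.CasselsTateLevelInputs
import HarnessLib

/-!
# Crux `ShimuraKolyvaginOrderBoundAtThreeSurj` (item stmt-BirchSwinnertonDyer-19899) — stub H BY ITS REGISTERED
# SIGNATURE from NAMED inputs only: Poitou–Tate, GZK over `ℚ`, modularity, the Literature fact
# `casselsTate_levelInputs` (BY NAME) and the Shimura CM-point PRIMITIVES at `p = 3`

Cell `bsd-stepL` (run/shared/lean/pub/bsd-stepL/), seat `bsd-stepL-shim3a` (prover g3), HELPER for the shared crux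
(`--supports stmt-BirchSwinnertonDyer-19899 --as helper`; K2@3 + KOLY; skeleton v3 b5621f5fb3bef0cc). Sequel of
`…SurjHOfPrimitives.lean` (p496956): there the levelwise Cassels–Tate inputs enter as the raw ∀∃-binder `hCT`; by
plan g30 RULING 5 (b) they are now ONE Literature named fact
`Literature.NumberTheory.EllipticCurves.casselsTate_levelInputs K` (file `Literature/…/CasselsTateLevelInputs.lean`,
this seat; clauses (i) ABHN reciprocity, (ii) local Tate duality `IsPerfect`, (iii) `Ш³(K, μ) = 0`, (iv) Milne I
6.13(a)+6.17 level pairing for the tree's `ctLevelPairing`, (v) `Gal(K/ℚ)`-equivariance of `ctGeneralFun`), and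
this file re-keys H on it:

* `stub_orderBoundSurj_heegnerPointAtThree_of_poitouTate_of_GZK_of_modularity_of_casselsTateLevelInputs_of_shimuraPrimitives`
  — stub H (registered signature VERBATIM) ⟸ {`hPT`, `hGZK`, `hE`, `hCTf`, `hPrim`} IN THIS ORDER (the binder order
  of a restated crux «PT → GZK → modularity → CT₃ (by Literature name) → π₃ → ‹19899 body›»; the first four are
  Literature statements by name, the fifth the PRIMITIVES aside text of p496956 — the only non-Literature binder).

HONEST FRAMING: CONDITIONAL on the five binders (four named Literature facts, none discharged; one construction-grade
aside: the CM-point family on `X_{N⁺,N⁻}` with its printed relations); item 19899 stays OPEN as registered; BSD is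
not proved by any of this; no census number moves (T7).
[cite: MilneADT2006, Ch. I Thm. 4.10(b)(c), §6 Thm. 6.13(a)] [cite: McCallumLMS1991, §1 Theorem (Kolyvagin), §5]
[cite: CaiShuTian2014, Thm. 1.5] [cite: GrossLMS1991, §§3–6] [cite: BertoliniDarmon1996, §2] [cite: Nekovar2007, (4.8), (4.9)]
[cite: Darmon2004, Thm. 3.22] [cite: BCDTJAMS2001, Thm. A] [cite: JetchevSkinnerWan2017, Thm. 4.4.1 (p. 19)]
presearch: as `…SurjHOfPrimitives`; `lean search 'casselsTate_levelInputs'` → the new Literature fact only.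
-/

noncomputable section

open scoped Classical AddSubgroup
set_option linter.dupNamespace false
namespace Summit.BirchSwinnertonDyer.BirchSwinnertonDyer.Theorems.ShimuraKolyvaginSurjHOfNamed

open WeierstrassCurve NumberField IsDedekindDomain Field Function CongruenceSubgroup
  Literature.NumberTheory.Automorphic Literature.NumberTheory.EllipticCurves.ModularForms
  Literature.NumberTheory.EllipticCurves Literature.NumberTheory.EllipticCurves.KolyvaginCocycle
  Literature.NumberTheory.EllipticCurves.KolyvaginEuler
  Literature.NumberTheory.EllipticCurves.KolyvaginDescent
  Literature.NumberTheory.EllipticCurves.RingClassField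
  Literature.NumberTheory.GaloisRepresentations Literature.NumberTheory.GaloisCohomology
  Literature.NumberTheory.NumberFields Literature.NumberTheory.DiophantineGeometry
  Summit.BirchSwinnertonDyer.Rank1Residual.X11b
  Summit.BirchSwinnertonDyer.BirchSwinnertonDyer.Theorems
  Summit.BirchSwinnertonDyer.BirchSwinnertonDyer.Theorems.ShimuraKolyvaginSurjHOfCarrier
  Summit.BirchSwinnertonDyer.BirchSwinnertonDyer.Theorems.ShimuraKolyvaginSurjHOfCarrierIndexFree
  Summit.BirchSwinnertonDyer.BirchSwinnertonDyer.Theorems.ShimuraKolyvaginSurjHOfPrimitives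
open Literature.NumberTheory.GaloisRepresentations.DiscreteGaloisModule (mu MuCarrier)


/-- **Stub H `stub_orderBoundSurj_heegnerPointAtThree` (registered signature VERBATIM) from NAMED inputs: Poitou–Tate
`hPT`, Gross–Zagier–Kolyvagin over `ℚ` `hGZK`, modularity `hE`, the Literature fact `casselsTate_levelInputs` (every
`K`) `hCTf`, and the Shimura CM-point PRIMITIVES `hPrim` at `p = 3`** — p496956 with its `hCT` binder supplied from
the named fact (injectivity at the finite places from `IsPerfect`). HONEST: conditional; H as registered stays OPEN.
[cite: MilneADT2006, Ch. I §6 Thm. 6.13(a)] [cite: McCallumLMS1991, §1 Theorem (Kolyvagin)] [cite: JetchevSkinnerWan2017, Thm. 4.4.1 (p. 19)] -/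
theorem stub_orderBoundSurj_heegnerPointAtThree_of_poitouTate_of_GZK_of_modularity_of_casselsTateLevelInputs_of_shimuraPrimitives
    (hPT : ∀ (K : Type) [Field K] [NumberField K], poitouTate_sum_localTatePairing_eq_zero K)
    (hGZK : rank_eq_analyticRank_of_analyticRank_le_one) (hE : WeierstrassCurve.hasEntireLFunction_rat)
    (hCTf : ∀ (K : Type) [Field K] [NumberField K], casselsTate_levelInputs K)
    (hPrim : ∀ (W : WeierstrassCurve ℚ) [W.IsElliptic] [W.IsGloballyMinimal] (p : ℕ) [Fact p.Prime]
      (N : ℕ) [NeZero N] (K : Type) [Field K] [NumberField K] (S : Finset ℕ)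
      (Dt : ModularParametrizationData W N)
      (X : ShimuraCurveData (∏ q ∈ S, q) (N / ∏ q ∈ S, q))
      (W' : WeierstrassCurve ℚ) [W'.IsElliptic] (P₀ : ShimuraParametrizationData X W'),
      W.conductorNorm ℤ = N → Literature.NumberTheory.EllipticCurves.Rank1Residual.Surj W 3 →
      p ≠ 2 → W.HasIrreducibleModPGaloisRep p →
      IsImaginaryQuadratic K → Even S.card →
      (∀ ℓ ∈ S, ℓ.Prime ∧ ℓ ∣ N ∧ ¬ ℓ ^ 2 ∣ N ∧
        ((Ideal.span {(ℓ : ℤ)}).primesOver (𝓞 K)).ncard = 1 ∧ ¬ (ℓ : ℤ) ∣ NumberField.discr K) →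
      (∀ ℓ : ℕ, ℓ.Prime → ℓ ∣ N → ℓ ∉ S → ((Ideal.span {(ℓ : ℤ)}).primesOver (𝓞 K)).ncard = 2) →
      ((Ideal.span {(p : ℤ)}).primesOver (𝓞 K)).ncard = 2 →
      P₀.IsMinimalFor W →
      p ∣ N → p = 3 →
      ∃ (ι : K →+* ℂ) (y : (m : ℕ) → (W.baseChange (ringClassField K ι m)).toAffine.Point)
        (yK : (W.baseChange K).toAffine.Point) (ε : ℤ) (degy : ℕ), 0 < degy ∧
        padicValNat p degy = padicValNat p P₀.deg ∧
        LDerivEK W K =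
            8 * (Real.pi : ℂ) ^ 2 * peterssonProduct (Gamma0 N) 2 Dt.f Dt.f /
                ((((Units.torsionOrder K : ℝ) / 2) ^ 2 * √|(NumberField.discr K : ℝ)| : ℝ) : ℂ) *
              ((yK.canonicalHeight : ℂ) / (degy : ℂ)) ∧
        (ε = 1 ∨ ε = -1) ∧
        (∀ T : Finset (ringClassField K ι 1 ≃ₐ[ℚ] ringClassField K ι 1),
          (∀ g, g ∈ T ↔ g ∈ ringClassGal ι 1) →
          WeierstrassCurve.Affine.Point.map (W' := W)
              (algebraMap K (ringClassField K ι 1)).toRatAlgHom yK =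
            ∑ g ∈ T, pointGalHom W (ringClassField K ι 1) g (y 1)) ∧
        (∀ (m : ℕ), m ≠ 0 → ∀ τm : ringClassField K ι m ≃ₐ[ℚ] ringClassField K ι m,
          (∀ x : ringClassField K ι m, ((τm x : ringClassField K ι m) : ℂ) = starRingEnd ℂ x) →
          ∃ σ' ∈ ringClassGal ι m, IsOfFinAddOrder
            (pointGalHom W (ringClassField K ι m) τm (y m) -
              ε • pointGalHom W (ringClassField K ι m) σ' (y m))) ∧
        (∀ c : K ≃ₐ[ℚ] K, c ≠ 1 →
          IsOfFinAddOrder (WeierstrassCurve.Affine.Point.map (W' := W) (c : K →ₐ[ℚ] K) yK - ε • yK)) ∧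
        (∀ m : ℕ, Squarefree m →
          (∀ q ∈ m.primeFactors, ¬ q ∣ N ∧ (Ideal.span {(q : 𝓞 K)}).IsPrime) →
          ∀ (ℓ : ℕ) (_ : ℓ ∈ m.primeFactors) (hle : ringClassField K ι (m / ℓ) ≤ ringClassField K ι m)
            (σ : ringClassField K ι m ≃ₐ[ℚ] ringClassField K ι m),
            Subgroup.zpowers σ = ringClassGalOver ι m (m / ℓ) →
            letI : Algebra K ℂ := ι.toAlgebra
            ∑ i ∈ Finset.range (ℓ + 1), pointGalHom W (ringClassField K ι m) (σ ^ i) (y m) =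
              W.frobeniusTrace ℓ • WeierstrassCurve.Affine.Point.map (W' := W)
                ((RingClassField.inclusion ι hle).restrictScalars ℚ) (y (m / ℓ))) ∧
        (∀ m : ℕ, Squarefree m →
          (∀ q ∈ m.primeFactors, ¬ q ∣ N ∧ (Ideal.span {(q : 𝓞 K)}).IsPrime) →
          ∀ (ℓ : ℕ) (_ : ℓ ∈ m.primeFactors) [Fact ℓ.Prime] (hΔ : ¬ (ℓ : ℤ) ∣ minimalDiscriminantInt W)
            (φ₀ : absoluteGaloisGroup (ZMod ℓ)), (∀ x : AlgebraicClosure (ZMod ℓ), φ₀ • x = x ^ ℓ) →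
          ∀ (hle : ringClassField K ι (m / ℓ) ≤ ringClassField K ι m)
            (emb : ringClassField K ι m →+* AlgebraicClosure K),
            (∀ x : K, emb (algebraMap K (ringClassField K ι m) x) = algebraMap K (AlgebraicClosure K) x) →
          ∀ (j : (W.baseChange (ringClassField K ι m)).toAffine.Point →+ geomPoints (W.baseChange K)),
            j = WeierstrassCurve.Affine.Point.map (W' := W) emb.toRatAlgHom →
          ∀ γ : ringClassField K ι m ≃ₐ[ℚ] ringClassField K ι m, γ ∈ ringClassGal ι m →
            letI : Algebra K ℂ := ι.toAlgebra
            geomReduction hΔ ((RatClosure.pointsEquiv (K := K) W).symm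
                (j (pointGalHom W (ringClassField K ι m) γ (y m)))) =
              φ₀ • geomReduction hΔ ((RatClosure.pointsEquiv (K := K) W).symm
                (j (pointGalHom W (ringClassField K ι m) γ
                  (WeierstrassCurve.Affine.Point.map (W' := W)
                    ((RingClassField.inclusion ι hle).restrictScalars ℚ) (y (m / ℓ)))))))) :
  ∀ (W : WeierstrassCurve ℚ) [W.IsElliptic] [W.IsGloballyMinimal] (p : ℕ) [Fact p.Prime]
    (N : ℕ) [NeZero N] (K : Type) [Field K] [NumberField K] (S : Finset ℕ)
    (Dt : ModularParametrizationData W N)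
    (X : ShimuraCurveData (∏ q ∈ S, q) (N / ∏ q ∈ S, q))
    (W' : WeierstrassCurve ℚ) [W'.IsElliptic] (P₀ : ShimuraParametrizationData X W'),
    W.conductorNorm ℤ = N → Literature.NumberTheory.EllipticCurves.Rank1Residual.Surj W 3 →
    p ≠ 2 → W.HasIrreducibleModPGaloisRep p →
    IsImaginaryQuadratic K → Even S.card →
    (∀ ℓ ∈ S, ℓ.Prime ∧ ℓ ∣ N ∧ ¬ ℓ ^ 2 ∣ N ∧
      ((Ideal.span {(ℓ : ℤ)}).primesOver (𝓞 K)).ncard = 1 ∧ ¬ (ℓ : ℤ) ∣ NumberField.discr K) →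
    (∀ ℓ : ℕ, ℓ.Prime → ℓ ∣ N → ℓ ∉ S → ((Ideal.span {(ℓ : ℤ)}).primesOver (𝓞 K)).ncard = 2) →
    ((Ideal.span {(p : ℤ)}).primesOver (𝓞 K)).ncard = 2 →
    P₀.IsMinimalFor W →
    p ∣ N → p = 3 →
    ∃ (P : (W.baseChange K).toAffine.Point) (degS : ℕ), 0 < degS ∧
      padicValNat p degS = padicValNat p P₀.deg ∧
      LDerivEK W K =
          8 * (Real.pi : ℂ) ^ 2 * peterssonProduct (Gamma0 N) 2 Dt.f Dt.f /
              ((((Units.torsionOrder K : ℝ) / 2) ^ 2 * √|(NumberField.discr K : ℝ)| : ℝ) : ℂ) *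
            ((P.canonicalHeight : ℂ) / (degS : ℂ)) ∧
      (¬ IsOfFinAddOrder P →
        Nat.card (AddCommGroup.primaryComponent (W.baseChange K).sha p) ≤
            p ^ (2 * padicValNat p (AddSubgroup.zmultiples P).index)) := by
  refine stub_orderBoundSurj_heegnerPointAtThree_of_shimuraPrimitives_of_casselsTate_of_GZK_of_poitouTate hPrim ?_
    hPT hGZK hE
  intro K _ _ W _ p M₀ hp hp2 hM₀ inst c hc hcc e hμ hadd₁ hadd₂ hgal halt hnd
  obtain ⟨inv, hPT', hH3, hperf, hB, hPτ⟩ := hCTf K W p M₀ hp hp2 hM₀ c hc hcc e hμ hadd₁ hadd₂ hgal halt hnd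
  exact ⟨inv, hPT', hH3, fun v ↦ (hperf v).1.injective, hB, hPτ⟩

end Summit.BirchSwinnertonDyer.BirchSwinnertonDyer.Theorems.ShimuraKolyvaginSurjHOfNamed

end
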